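import Summits.QuantumFields.YangMills.Theorems.BalabanUVNodesK1RunRowsOfU2Letters
import Summits.QuantumFields.YangMills.Theorems.BalabanUVNodesK1R9VersionSlotDefs
import Summits.QuantumFields.BalabanUV.Beta.EriceRemainderEnclosureHistoryAutonomyMonotoneFlat

/-!
# Route `BalabanUVNodes` rev 29 — THE FADING-FREE ROW-MASS ROAD TO THE RUN ROWS (hypothesis form; 0 `def`, 0 `sorry`):
# U3ᴷ-lite history moduli WITH BOUNDED ROW MASS + ONE displayed lower-(0.31) run per depth ⟹ the averaged-AF carrier `BetaAvgAFH (s∕4) (4L²∕s²) δ β`, hence the rows (i)(iv)(C)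
# of the K1 cruxes' run-letter currency — via the EXTREMAL (0.31)-PROFILE `u_i = (1∕γ² + s(K−i))^{−1∕2}` (generic `β : HBeta`; the keyed ∕ by-name conclusions are the sibling file `…Keyed`)

Cell `ym-nodeO-ideate`, PROVER seat `ym-nodeO-port-1` (gen 5).  PORT under `Theorems/` of ym-nodeO IDEA-7 g13's crux workfile `Cruxes/EndpointGivenBR13SepCoPH/Idea7RunCurrency.lean`
ED.2 (commit 93fe73230dca) §0 + §B «the R-BM re-cut of bflow-p2's (α) road» — CRIT-2 g3 ROUND 8 CONFIRMED ∕ SURVIVES priced (HOME STATUS 2026-08-28T11:30:47Z, sheet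
`Cruxes/EndpointGivenBR13SepCoPH/CRIT-2-ROUND8-corner-limit-sign.md` 5845e801114e).  Crux workfiles are not importable from `Theorems/`; this file RE-PROVES the theorems (proof scripts
after idea-7 g13, with the definition `profile031` replaced by the explicit expression `1 ∕ √(1∕γ² + s(K−i))`, so the module declares NO `def`).  ATTRIBUTION: the displayed-run road
(one lower-(0.31) run per depth ⟹ constant-history drift ⟹ crew CAP's carrier ⟹ rows) is b2b-balaban-beta-bflow-p2's (gen 50, #70a p622202 `…B12AsPrintedPointwiseFadingRunRows` ∕ #70b
p623153 `…Theorems.BalabanUVNodesK1RunRowsOfU2Letters` ∕ part 10 `…PointwiseFadingDrift.betaAvgAFH_of_runs_fadingMemory`), whose lemmas `sum_run_le_of_discrete031`, `sqrt_absorb`,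
`survCont_of_moduli`, `runwisePS_of_betaPartialSumsLowerH` are consumed BY NAME; the currency swap `FadingMemory ↦ bounded row mass` is CRIT-2's R-BM (E-CRIT2-2, HOME STATUS S.2003) ∕ this
seat's p622247 `U3LiteK`; the observation that the fading letter is NOT load-bearing on that road (the pre-window history is handled by the extremal profile, with a SMALLER defect) is
IDEA-7 g13's.  Helper keyed `--supports stmt-QuantumFields-27364 --as helper` (K1⁹ `StabilityBRunRowsAtRecordR13SepCoPHV`, DECIDING); count-neutral; NO skeleton registered or re-keyed.

THE MATHEMATICS ([folklore] real analysis about an abstract history-dependent recursion `1∕g²_k = 1∕g²_{k+1} + β_k(g_0,…,g_k)` — the tree's `FlowStep.RGEqH`, print's sign: [Balaban1987RG1] (0.18) p. 255, (0.20) p. 256).  Inputs at ONE `β`: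
(U3ᴷ-lite) `HistLipschitz Λ γ β` — `|β_k p − β_k q| ≤ Σ_i Λ_{k,i} |p_i − q_i|` on the box `]0, γ]^{k+1}` ([I] (2.12)–(2.14) p. 268 shape) — with ROW MASS `Σ_i |Λ_{k,i}| ≤ L`; (α♭) for EVERY
depth `K` ONE solution `r` of (0.20) inside `]0, γ]` obeying the two-sided (0.31) `1∕r_K² + s(K−i) ≤ 1∕r_i² ≤ 1∕r_K² + s′(K−i)` ([I] Thm 2 (0.31) p. 259 read as a HYPOTHESIS — UNPROVED IN
PRINT).  §1: every entry of such a run is majorised by the extremal profile `u_i := (1∕γ² + s(K−i))^{−1∕2}` (which satisfies (0.31) with equality and `Σ_{[k,K)} u ≤ 2√(K−k)∕√s`,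
bflow-p2's `sum_run_le_of_discrete031`); moving the run to the CONSTANT history `δ̄` costs `L(u_j + δ)` per scale (row mass), so (§2) the constant-history window sums drift two-sidedly,
`s(K−k) − E ≤ Σ_{[k,K)} β_j(δ̄) ≤ s′(K−k) + E`, `E = Lδ(K−k) + (2L∕√s)√(K−k)`; along ANY `]0, δ]`-history each term is within `Lδ` of the constant-history value, and `(2L∕√s)√N ≤ (s∕4)N +
4L²∕s²` (`sqrt_absorb`) ⟹ ★★ `betaAvgAFH_of_runs_rowMass : BetaAvgAFH (s∕4) (4L²∕s²) δ β` whenever `4Lδ ≤ s` — NO fading memory, NO NE4 (the comparison with bflow-p2's fading road is in the sibling file).  §3: the ROWS in the K1 run-letter currency: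
(i) `|β_k(g_0..g_k) − β_k(γ₀̄)| ≤ Lγ₀` along in-window runs of level `γ₀` (radius PROPORTIONAL to the level), (ii) NEW here: the reference sequence `b_k := β_k(γ₀̄)` is BOUNDED, `b_k ≤ s′ + Lγ₀ +
2L∕√s` (the `b ≤ B` row the registered K1 stubs ask), (iv) the run-wise partial-sum floor `−4L²∕s²` (`BetaAvgAFH.partialSums` ⟶ `runwisePS_of_betaPartialSumsLowerH`), (C) survivor
continuity from the moduli (`survCont_of_moduli`) — ★★ `rowsTriple_of_runs_rowMass` ∕ ★★ `rowsBounded_of_runs_rowMass` at `γ₀ := min γ (s∕(4(L+1)))`.  ANCHOR-FREE, JET-FREE,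
DRIFT-FREE, CAP-FREE, NE4-FREE, FADING-FREE.  §4 (keyed, minimal): DEF-1's `RunRowsCont13 F θ` at a tuple; the ∀θ row-mass-runs letter (idea-7's `RowMassRunsAll`, spelled INLINE — no `def`) ⟹
`RowsContAll`; and the DECIDING K1⁹ `StabilityBRunRowsAtRecordR13SepCoPHV` BY NAME from the aside K1⁷ + that letter through DEF-1's doors (`…_of_k17_rowsContAll`, `…_of_k1R8`).  The LINE-2 ∕
V-rung editions, the [I] Thm 2-AS-TYPED interface and the fading comparisons are the sibling `…K2CornerRoadRowMassRunsKeyed`.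

HONEST FRAMING.  Elementary real analysis on DISPLAYED hypothesis shapes; NOTHING of Bałaban's analysis is asserted or discharged; whether U3ᴷ-lite (moduli + row mass) and the (α♭) run
family are inhabited by the β of record at any Stage-13 tuple is the U3 ∕ B12 sub-cell's question, NOT claimed (instance 0∕1); no stub proved or closed; K0⁷ ∕ K1⁹ ∕ K3⁸ OPEN; counts
unmoved (typed 28∕28 · discharged 5∕27 (A 5∕28)); [Balaban1987RG1] Thm 2 + (0.31) p. 259 and §1's continuity are UNPROVED IN PRINT; route R4 closes the CONDITIONAL finite-𝕋⁴ rung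
`BalabanLadder.UV` only — NOT the continuum limit, NOT ℝ⁴, NOT OS, NOT the Yang–Mills mass gap, NOT Clay.  No `def`, no `instance`, no `notation`, no `axiom`.
Sources (context only): [I] = [Balaban1987RG1] CMP **109** (1987): (0.20) p. 256, Thm 2 + (0.31) p. 259, §1 pp. 263–264, Thm 3 p. 264, (2.12)–(2.14) p. 268, (5.10) p. 293, §5 p. 298.
-/

noncomputable section

namespace Summit.QuantumFields.YangMills.Theorems.BalabanUVNodesK2CornerRoadRowMassRuns

open Finset
open Literature.MathematicalPhysics.QuantumFieldTheory.Balaban1983to89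
open Literature.MathematicalPhysics.QuantumFieldTheory.Balaban1983to89.FlowStep (HBeta prefixOf prefixOf_apply Box mem_box box_mono RGEqH BetaContH clampPrefix Y inv_sq_telescopeH)
open Literature.MathematicalPhysics.QuantumFieldTheory.Balaban1983to89.FlowStepRuns (BetaPartialSumsLowerH)
open Literature.MathematicalPhysics.QuantumFieldTheory.Balaban1983to89.T4CouplingMatching (HistLipschitz)
open Literature.MathematicalPhysics.QuantumFieldTheory.Balaban1983to89.Beta.AveragedAFCarrier (BetaAvgAFH)
open Summit.QuantumFields.BalabanUV.Gaps.EndRunwiseCone (runwisePS_of_betaPartialSumsLowerH)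
open Summit.QuantumFields.BalabanUV.Beta.EriceRemainderEnclosureHistoryAutonomyMonotoneFlat (le_of_one_div_sq_le')
open Summit.QuantumFields.BalabanUV.Beta.EriceFlowEnclosureB12AsPrintedTunedUpper (prefixOf_mem_box_of_inInterval)
open Summit.QuantumFields.BalabanUV.Beta.EriceFlowEnclosureB12AsPrintedPointwiseFaceDrift (sum_run_le_of_discrete031)
open Summit.QuantumFields.BalabanUV.Beta.EriceFlowEnclosureB12AsPrintedPointwiseFadingDrift (sqrt_absorb)
open Summit.QuantumFields.BalabanUV.Beta.EriceFlowEnclosureB12AsPrintedPointwiseFadingRunRows (survCont_of_moduli)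
open Literature.MathematicalPhysics.QuantumFieldTheory.Balaban1983to89.T4Continuum (T4Family)
open Summit.QuantumFields.YangMills.Theorems.BalabanUVNodesK1R8RowsDefs (RunRowsCont13 RowsContAll runRowsCont13_iff_inline rowsContAll_of_adm stabilityBRunRowsAtRecordR13SepCoPH_of_k17_rowsContAll)
open Summit.QuantumFields.YangMills.Theses.BalabanUVNodes (StabilityBAtRecordR13SepCoPH StabilityBRunRowsAtRecordR13SepCoPH StabilityBRunRowsAtRecordR13SepCoPHV)
open Summit.QuantumFields.YangMills.Theorems.BalabanUVNodesK1R9VersionSlotDefs (stabilityBRunRowsAtRecordR13SepCoPHV_of_k1R8)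

/-! ## §0 Helpers: the row-mass transfer (inverse squares: bflow's `le_of_one_div_sq_le'` BY NAME) -/

section Helpers

/-- **ROW-MASS TRANSFER** (U3ᴷ-lite currency; CRIT-2 R-BM ∕ p622247 `U3LiteK`; idea-7 g13 `abs_sub_le_rowMass`): `HistLipschitz Λ γ β` with `Σ_i |Λ_{k,i}| ≤ L` and two histories of the
γ-box differing coordinatewise by at most `d ≥ 0` ⟹ `|β_j p − β_j q| ≤ L·d`. [cite: Balaban1987RG1, (2.12)-(2.14) p.268 and §5 p.298 (statement shape)] -/
theorem abs_sub_le_rowMass {β : HBeta} {γ L : ℝ} {Λ : ℕ → ℕ → ℝ} (hL : HistLipschitz Λ γ β) (hM : ∀ k, ∑ i : Fin (k + 1), |Λ k i| ≤ L)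
    {j : ℕ} {p q : Fin (j + 1) → ℝ} (hp : p ∈ Box γ j) (hq : q ∈ Box γ j) {d : ℝ} (hd0 : 0 ≤ d) (hd : ∀ i, |p i - q i| ≤ d) :
    |β j p - β j q| ≤ L * d := by
  have h1 := hL j p q hp hq
  have h2 : ∑ i : Fin (j + 1), Λ j i * |p i - q i| ≤ ∑ i : Fin (j + 1), |Λ j i| * d :=
    Finset.sum_le_sum fun i _ =>
      calc Λ j i * |p i - q i| ≤ |Λ j i| * |p i - q i| := mul_le_mul_of_nonneg_right (le_abs_self _) (abs_nonneg _)
        _ ≤ |Λ j i| * d := mul_le_mul_of_nonneg_left (hd i) (abs_nonneg _)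
  rw [← Finset.sum_mul] at h2
  exact h1.trans (h2.trans (mul_le_mul_of_nonneg_right (hM j) hd0))

/-- Row mass is nonnegative, so `0 ≤ L`. [folklore] -/
theorem rowMass_nonneg {Λ : ℕ → ℕ → ℝ} {L : ℝ} (hM : ∀ k, ∑ i : Fin (k + 1), |Λ k i| ≤ L) : 0 ≤ L :=
  (Finset.sum_nonneg fun (i : Fin (0 + 1)) (_ : i ∈ Finset.univ) => abs_nonneg (Λ 0 i)).trans (hM 0)

end Helpers

/-! ## §1 The extremal (0.31)-profile `u_i = 1 ∕ √(1∕γ² + s(K−i))` (spelled inline — no `def`) majorises every run entry -/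

section Profile

variable {γ s s' : ℝ}

/-- The radicand of the profile is positive for `i ≤ K`. [folklore] -/
theorem profile_radicand_pos (hγ : 0 < γ) (hs : 0 ≤ s) {K i : ℕ} (hi : i ≤ K) : 0 < 1 / γ ^ 2 + s * ((K : ℝ) - i) := by
  have h1 : 0 < 1 / γ ^ 2 := by positivity
  have h2 : (0 : ℝ) ≤ (K : ℝ) - i := by
    have : (i : ℝ) ≤ K := Nat.cast_le.mpr hi
    linarith
  have h3 : 0 ≤ s * ((K : ℝ) - i) := mul_nonneg hs h2
  linarith

/-- The profile is positive. [folklore] -/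
theorem profile_pos (hγ : 0 < γ) (hs : 0 ≤ s) {K i : ℕ} (hi : i ≤ K) : 0 < 1 / Real.sqrt (1 / γ ^ 2 + s * ((K : ℝ) - i)) := by
  have := profile_radicand_pos hγ hs hi
  positivity

/-- The profile satisfies (0.31) at slope `s` WITH EQUALITY: `1∕u_i² = 1∕γ² + s(K−i)`. [cite: Balaban1987RG1, (0.31) p.259 (statement shape)] -/
theorem inv_sq_profile (hγ : 0 < γ) (hs : 0 ≤ s) {K i : ℕ} (hi : i ≤ K) :
    1 / (1 / Real.sqrt (1 / γ ^ 2 + s * ((K : ℝ) - i))) ^ 2 = 1 / γ ^ 2 + s * ((K : ℝ) - i) := by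
  have hy := profile_radicand_pos hγ hs hi
  rw [div_pow, one_pow, Real.sq_sqrt hy.le, one_div_one_div]

/-- The profile ends at `γ`: `u_K = γ`. [folklore] -/
theorem profile_last (hγ : 0 < γ) (s : ℝ) (K : ℕ) : 1 / Real.sqrt (1 / γ ^ 2 + s * ((K : ℝ) - K)) = γ := by
  have h : Real.sqrt (1 / γ ^ 2) = 1 / γ := by
    rw [show (1 : ℝ) / γ ^ 2 = (1 / γ) ^ 2 by ring]; exact Real.sqrt_sq (by positivity)
  simp only [sub_self, mul_zero, add_zero, h, one_div_one_div]

/-- The profile increases with the scale index. [folklore] -/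
theorem profile_mono (hγ : 0 < γ) (hs : 0 ≤ s) {K i j : ℕ} (hij : i ≤ j) (hj : j ≤ K) :
    1 / Real.sqrt (1 / γ ^ 2 + s * ((K : ℝ) - i)) ≤ 1 / Real.sqrt (1 / γ ^ 2 + s * ((K : ℝ) - j)) := by
  refine le_of_one_div_sq_le' (profile_pos hγ hs (hij.trans hj)) (profile_pos hγ hs hj) ?_
  rw [inv_sq_profile hγ hs hj, inv_sq_profile hγ hs (hij.trans hj)]
  have : (i : ℝ) ≤ j := Nat.cast_le.mpr hij
  nlinarith

/-- **EVERY RUN ENTRY IS MAJORISED BY THE PROFILE** (idea-7 g13 `run_le_profile031`): a run inside `]0, γ]` with `Step.Discrete031 s s′ K (r_K) r` (`s ≥ 0`) has `r_i ≤ u_i` for all `i ≤ K`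
(`1∕r_i² ≥ 1∕r_K² + s(K−i) ≥ 1∕γ² + s(K−i)`). [cite: Balaban1987RG1, (0.31) p.259 (statement shape)] -/
theorem run_le_profile (hγ : 0 < γ) (hs : 0 ≤ s) {K : ℕ} {r : ℕ → ℝ} (hI : Step.InInterval γ K r) (hD : Step.Discrete031 s s' K (r K) r)
    {i : ℕ} (hi : i ≤ K) : r i ≤ 1 / Real.sqrt (1 / γ ^ 2 + s * ((K : ℝ) - i)) := by
  have hri := (hI i hi).1
  have hrK := hI K le_rfl
  have hKγ : 1 / γ ^ 2 ≤ 1 / (r K) ^ 2 :=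
    one_div_le_one_div_of_le (pow_pos hrK.1 2) (sq_le_sq' (by linarith [hrK.1, hrK.2]) hrK.2)
  have h31 := (hD i hi).1
  refine le_of_one_div_sq_le' hri (profile_pos hγ hs hi) ?_
  rw [inv_sq_profile hγ hs hi]
  linarith

/-- The profile is itself a (0.31)-run at slopes `s = s′ = s` ending at `γ` (so bflow-p2's `sum_run_le_of_discrete031` applies to it: `Σ_{[k,K)} u ≤ 2√(K−k)∕√s`). [cite: Balaban1987RG1, (0.31) p.259 (statement shape)] -/
theorem profile_discrete031 (hγ : 0 < γ) (hs : 0 ≤ s) (K : ℕ) :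
    Step.Discrete031 s s K ((fun i : ℕ => 1 / Real.sqrt (1 / γ ^ 2 + s * ((K : ℝ) - i))) K) (fun i : ℕ => 1 / Real.sqrt (1 / γ ^ 2 + s * ((K : ℝ) - i))) := by
  intro i hi
  show 1 / (1 / Real.sqrt (1 / γ ^ 2 + s * ((K : ℝ) - K))) ^ 2 + s * ((K : ℝ) - i) ≤ 1 / (1 / Real.sqrt (1 / γ ^ 2 + s * ((K : ℝ) - i))) ^ 2 ∧
    1 / (1 / Real.sqrt (1 / γ ^ 2 + s * ((K : ℝ) - i))) ^ 2 ≤ 1 / (1 / Real.sqrt (1 / γ ^ 2 + s * ((K : ℝ) - K))) ^ 2 + s * ((K : ℝ) - i)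
  rw [profile_last hγ s K, inv_sq_profile hγ hs hi]
  exact ⟨le_rfl, le_rfl⟩

end Profile

/-! ## §2 Constant-history drift and the averaged-AF carrier in row-mass currency (no fading memory, no NE4) -/

section Recut

variable {β : HBeta} {γ L δ s s' : ℝ} {Λ : ℕ → ℕ → ℝ}

/-- **ONE LATTICE, ONE WINDOW, ROW-MASS CURRENCY** (idea-7 g13 `constDrift_window_rowMass`).  `HistLipschitz Λ γ β` with row mass `≤ L`, `0 < δ ≤ γ`, and a run of (0.20) of depth `K` inside
`]0, γ]` with `Step.Discrete031 s s′ K (r_K) r` (`s > 0`) ⟹ the CONSTANT-history window sums drift two-sidedly: `s(K−k) − E ≤ Σ_{[k,K)} β_j(δ,…,δ) ≤ s′(K−k) + E`,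
`E = Lδ(K−k) + (2L∕√s)√(K−k)` — the telescoped (0.20) along the run gives `Σ_{[k,K)} β_j(run) = 1∕r_k² − 1∕r_K² ∈ [s(K−k), s′(K−k)]`; move the run to the constant history scale by scale at
cost `L(u_j + δ)` (`abs_sub_le_rowMass`, `run_le_profile`, `profile_mono`), and `Σ_{[k,K)} u ≤ 2√(K−k)∕√s` (bflow-p2's `sum_run_le_of_discrete031` on the profile).  NO fading memory.
[cite: Balaban1987RG1, Thm 2 (0.31) p.259 with (0.20) p.256 and §5 p.298] -/
theorem constDrift_window_rowMass (hL : HistLipschitz Λ γ β) (hM : ∀ k, ∑ i : Fin (k + 1), |Λ k i| ≤ L) (hδ : 0 < δ) (hδγ : δ ≤ γ) (hs : 0 < s)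
    {K : ℕ} {r : ℕ → ℝ} (hrg : RGEqH K β r) (hI : Step.InInterval γ K r) (hD : Step.Discrete031 s s' K (r K) r) {k : ℕ} (hk : k ≤ K) :
    s * ((K : ℝ) - k) - (L * δ * ((K : ℝ) - k) + 2 * L / Real.sqrt s * Real.sqrt ((K : ℝ) - k)) ≤ ∑ j ∈ Ico k K, β j (fun _ : Fin (j + 1) => δ) ∧
      ∑ j ∈ Ico k K, β j (fun _ : Fin (j + 1) => δ) ≤ s' * ((K : ℝ) - k) + (L * δ * ((K : ℝ) - k) + 2 * L / Real.sqrt s * Real.sqrt ((K : ℝ) - k)) := by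
  have hγ : 0 < γ := hδ.trans_le hδγ
  have hL0 : 0 ≤ L := rowMass_nonneg hM
  have htel := inv_sq_telescopeH hrg hk le_rfl
  have h31 := hD k hk
  set u : ℕ → ℝ := fun i => 1 / Real.sqrt (1 / γ ^ 2 + s * ((K : ℝ) - i)) with hu
  have hupos : ∀ i, i ≤ K → 0 < u i := fun i hi => profile_pos hγ hs.le hi
  have hDu : Step.Discrete031 s s K (u K) u := profile_discrete031 hγ hs.le K
  have hsumU : ∑ j ∈ Ico k K, u j ≤ 2 * Real.sqrt ((K : ℝ) - k) / Real.sqrt s := sum_run_le_of_discrete031 hs hupos hDu hk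
  have hterm : ∀ j ∈ Ico k K, |β j (prefixOf r j) - β j (fun _ : Fin (j + 1) => δ)| ≤ L * (u j + δ) := by
    intro j hj
    have hjK : j ≤ K := (mem_Ico.mp hj).2.le
    have hp : prefixOf r j ∈ Box γ j := prefixOf_mem_box_of_inInterval hI hjK
    have hq : (fun _ : Fin (j + 1) => δ) ∈ Box γ j := mem_box.mpr fun _ => ⟨hδ, hδγ⟩
    have huj := hupos j hjK
    refine abs_sub_le_rowMass hL hM hp hq (by linarith) fun i => ?_
    rw [prefixOf_apply]
    have hiK : (i : ℕ) ≤ K := by have := i.isLt; omega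
    have hij : (i : ℕ) ≤ j := Nat.le_of_lt_succ i.isLt
    have hri := hI i hiK
    have h1 : r i ≤ u i := run_le_profile hγ hs.le hI hD hiK
    have h2 : u i ≤ u j := profile_mono hγ hs.le hij hjK
    rw [abs_sub_le_iff]; constructor <;> linarith [hri.1]
  have hdiff : |∑ j ∈ Ico k K, β j (prefixOf r j) - ∑ j ∈ Ico k K, β j (fun _ : Fin (j + 1) => δ)| ≤ ∑ j ∈ Ico k K, L * (u j + δ) := by
    rw [← Finset.sum_sub_distrib]
    exact (Finset.abs_sum_le_sum_abs _ _).trans (Finset.sum_le_sum hterm)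
  have hcard : ((#(Ico k K) : ℕ) : ℝ) = (K : ℝ) - k := by rw [Nat.card_Ico, Nat.cast_sub hk]
  have hE : ∑ j ∈ Ico k K, L * (u j + δ) ≤ L * δ * ((K : ℝ) - k) + 2 * L / Real.sqrt s * Real.sqrt ((K : ℝ) - k) := by
    have e : ∑ j ∈ Ico k K, L * (u j + δ) = L * ∑ j ∈ Ico k K, u j + L * δ * ((K : ℝ) - k) := by
      calc ∑ j ∈ Ico k K, L * (u j + δ) = ∑ j ∈ Ico k K, (L * u j + L * δ) := Finset.sum_congr rfl fun j _ => by ring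
        _ = L * ∑ j ∈ Ico k K, u j + #(Ico k K) • (L * δ) := by rw [Finset.sum_add_distrib, Finset.mul_sum, Finset.sum_const]
        _ = L * ∑ j ∈ Ico k K, u j + L * δ * ((K : ℝ) - k) := by rw [nsmul_eq_mul, hcard]; ring
    rw [e]
    have h1 : L * ∑ j ∈ Ico k K, u j ≤ L * (2 * Real.sqrt ((K : ℝ) - k) / Real.sqrt s) := mul_le_mul_of_nonneg_left hsumU hL0
    have h2 : L * (2 * Real.sqrt ((K : ℝ) - k) / Real.sqrt s) = 2 * L / Real.sqrt s * Real.sqrt ((K : ℝ) - k) := by ring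
    linarith
  obtain ⟨hd1, hd2⟩ := abs_sub_le_iff.mp hdiff
  constructor <;> linarith [h31.1, h31.2]

/-- **ALL WINDOWS** (idea-7 g13 `constDrift_of_runs_rowMass`): with a displayed (0.31)-run for EVERY depth, the constant-history windows `[k, k+N)` obey
`sN − (LδN + (2L∕√s)√N) ≤ Σ β_j(δ̄) ≤ s′N + (LδN + (2L∕√s)√N)` (use the run of depth `k+N`). [cite: Balaban1987RG1, Thm 2 (0.31) p.259 with (0.20) p.256] -/
theorem constDrift_of_runs_rowMass (hL : HistLipschitz Λ γ β) (hM : ∀ k, ∑ i : Fin (k + 1), |Λ k i| ≤ L) (hδ : 0 < δ) (hδγ : δ ≤ γ) (hs : 0 < s)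
    (hruns : ∀ K : ℕ, ∃ r : ℕ → ℝ, RGEqH K β r ∧ Step.InInterval γ K r ∧ Step.Discrete031 s s' K (r K) r) (k N : ℕ) :
    s * N - (L * δ * N + 2 * L / Real.sqrt s * Real.sqrt N) ≤ ∑ j ∈ Ico k (k + N), β j (fun _ : Fin (j + 1) => δ) ∧
      ∑ j ∈ Ico k (k + N), β j (fun _ : Fin (j + 1) => δ) ≤ s' * N + (L * δ * N + 2 * L / Real.sqrt s * Real.sqrt N) := by
  obtain ⟨r, hrg, hI, hD⟩ := hruns (k + N)
  have h := constDrift_window_rowMass hL hM hδ hδγ hs hrg hI hD (Nat.le_add_right k N)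
  have hcast : (((k + N : ℕ) : ℝ) - k) = (N : ℝ) := by push_cast; ring
  rw [hcast] at h
  exact h

/-- **THE CONSTANT-HISTORY VALUES ARE BOUNDED ABOVE** (NEW in the port; the `b ≤ B` row of the registered K1 stub texts): `β_k(δ,…,δ) ≤ s′ + Lδ + 2L∕√s` for every `k` (the window
`[k, k+1)` of `constDrift_of_runs_rowMass`). [cite: Balaban1987RG1, Thm 2 (0.31) p.259 with (0.20) p.256, (1.22) p.264 (statement shapes)] -/
theorem constHist_le_of_runs_rowMass (hL : HistLipschitz Λ γ β) (hM : ∀ k, ∑ i : Fin (k + 1), |Λ k i| ≤ L) (hδ : 0 < δ) (hδγ : δ ≤ γ) (hs : 0 < s)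
    (hruns : ∀ K : ℕ, ∃ r : ℕ → ℝ, RGEqH K β r ∧ Step.InInterval γ K r ∧ Step.Discrete031 s s' K (r K) r) (k : ℕ) :
    β k (fun _ : Fin (k + 1) => δ) ≤ s' + L * δ + 2 * L / Real.sqrt s := by
  have h := (constDrift_of_runs_rowMass hL hM hδ hδγ hs hruns k 1).2
  simp only [Nat.cast_one, mul_one, Real.sqrt_one] at h
  have e : ∑ j ∈ Ico k (k + 1), β j (fun _ : Fin (j + 1) => δ) = β k (fun _ : Fin (k + 1) => δ) := by
    rw [Nat.Ico_succ_singleton, Finset.sum_singleton]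
  linarith [e.symm.le, e.le]

/-- **★★ crew CAP's AVERAGED-AF CARRIER FROM THE DISPLAYED (0.31)-RUN FAMILY IN ROW-MASS CURRENCY — NO FADING MEMORY, NO NE4** (idea-7 g13 `betaAvgAFH_of_runs_rowMass`).
`HistLipschitz Λ γ β` with row mass `≤ L`, a run of (0.20) inside `]0, γ]` obeying `Step.Discrete031 s s′ K (r_K) r` for EVERY depth `K` (`s > 0`), and a box `0 < δ ≤ γ` with `4Lδ ≤ s` ⟹
`BetaAvgAFH (s∕4) (4L²∕s²) δ β`: along EVERY `]0, δ]`-history every window sum is `≥ (s∕4)(n−k) − 4L²∕s²` (each term within `Lδ ≤ s∕4` of the constant-history value;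
`constDrift_of_runs_rowMass`; `(2L∕√s)√N ≤ (s∕4)N + 4L²∕s²` by bflow-p2's `sqrt_absorb`).  Compare bflow-p2 part 10's `betaAvgAFH_of_runs_fadingMemory` (`L = C∕(1−θ)` and an extra
defect `Cγθ∕(1−θ)²` from fading out the pre-window history): here the pre-window history is handled by the profile, so the fading letter drops out.  CONDITIONAL on the displayed
hypotheses; nothing of Bałaban's β asserted. [cite: Balaban1987RG1, Thm 2 (0.31) p.259 with (0.20) p.256, Thm 3 p.264, §5 p.298] -/
theorem betaAvgAFH_of_runs_rowMass (hL : HistLipschitz Λ γ β) (hM : ∀ k, ∑ i : Fin (k + 1), |Λ k i| ≤ L) (hδ : 0 < δ) (hδγ : δ ≤ γ) (hs : 0 < s)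
    (hsmall : 4 * L * δ ≤ s) (hruns : ∀ K : ℕ, ∃ r : ℕ → ℝ, RGEqH K β r ∧ Step.InInterval γ K r ∧ Step.Discrete031 s s' K (r K) r) :
    BetaAvgAFH (s / 4) (4 * L ^ 2 / s ^ 2) δ β := by
  intro v hv k n hkn
  have hL0 : 0 ≤ L := rowMass_nonneg hM
  obtain ⟨N, rfl⟩ : ∃ N, n = k + N := ⟨n - k, by omega⟩
  have hcast : (((k + N : ℕ) : ℝ) - k) = (N : ℝ) := by push_cast; ring
  rw [hcast]
  obtain ⟨hlo, -⟩ := constDrift_of_runs_rowMass hL hM hδ hδγ hs hruns k N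
  have hterm : ∀ j ∈ Ico k (k + N), β j (fun _ : Fin (j + 1) => δ) - L * δ ≤ β j (prefixOf v j) := by
    intro j _
    have hp : prefixOf v j ∈ Box γ j := mem_box.mpr fun i => by rw [prefixOf_apply]; exact ⟨(hv i).1, (hv i).2.trans hδγ⟩
    have hq : (fun _ : Fin (j + 1) => δ) ∈ Box γ j := mem_box.mpr fun _ => ⟨hδ, hδγ⟩
    have h := abs_sub_le_rowMass hL hM hp hq hδ.le fun i => by
      rw [prefixOf_apply, abs_sub_le_iff]; constructor <;> linarith [(hv i).1, (hv i).2]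
    linarith [(abs_le.mp h).1]
  have hsum := Finset.sum_le_sum hterm
  rw [Finset.sum_sub_distrib, Finset.sum_const, Nat.card_Ico, nsmul_eq_mul, Nat.add_sub_cancel_left] at hsum
  have hab := sqrt_absorb (A := 2 * L / Real.sqrt s) hs N
  have hA : (2 * L / Real.sqrt s) ^ 2 / s = 4 * L ^ 2 / s ^ 2 := by
    rw [div_pow, Real.sq_sqrt hs.le]; ring
  rw [hA] at hab
  have hN0 : (0 : ℝ) ≤ N := Nat.cast_nonneg N
  have h4 : L * δ * N ≤ s / 4 * N := mul_le_mul_of_nonneg_right (by linarith) hN0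
  have h4' : (N : ℝ) * (L * δ) ≤ s / 4 * N := by linarith
  linarith

/-- **THE (α♭) SUPPLIER's OWN `b` DRIFTS UPWARD** (idea-7 g13 `constHist_windowFloor_of_runs_rowMass`; consistency with the run-currency floor transfer): under the hypotheses of
`betaAvgAFH_of_runs_rowMass` the constant-history values have every window sum `≥ (s∕4)(n−k) − 4L²∕s²`. [cite: Balaban1987RG1, Thm 2 (0.31) p.259 with (0.20) p.256] -/
theorem constHist_windowFloor_of_runs_rowMass (hL : HistLipschitz Λ γ β) (hM : ∀ k, ∑ i : Fin (k + 1), |Λ k i| ≤ L) (hδ : 0 < δ) (hδγ : δ ≤ γ) (hs : 0 < s)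
    (hsmall : 4 * L * δ ≤ s) (hruns : ∀ K : ℕ, ∃ r : ℕ → ℝ, RGEqH K β r ∧ Step.InInterval γ K r ∧ Step.Discrete031 s s' K (r K) r) :
    ∀ k n : ℕ, k ≤ n → s / 4 * ((n : ℝ) - k) - 4 * L ^ 2 / s ^ 2 ≤ ∑ j ∈ Ico k n, β j (fun _ : Fin (j + 1) => δ) := by
  intro k n hkn
  have h := betaAvgAFH_of_runs_rowMass hL hM hδ hδγ hs hsmall hruns (fun _ => δ) (fun _ => ⟨hδ, le_rfl⟩) k n hkn
  have e : ∀ j, prefixOf (fun _ : ℕ => δ) j = fun _ : Fin (j + 1) => δ := fun j => funext fun i => by rw [prefixOf_apply]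
  simpa only [e] using h

end Recut

/-! ## §3 The rows (i)(ii)(iv)(C) of the K1 run-letter currency in row-mass currency -/

section Rows

variable {β : HBeta} {γ L s s' : ℝ} {Λ : ℕ → ℕ → ℝ}

/-- **ROW (i) IN ROW-MASS CURRENCY** (idea-7 g13 `runRem_constHist_of_rowMass`): along every in-window solution of (0.20) inside `]0, γ₀]` (`γ₀ ≤ γ`),
`|β_k(g_0..g_k) − β_k(γ₀,…,γ₀)| ≤ L·γ₀` — radius PROPORTIONAL to the level, reference sequence `b_k := β_k(γ₀̄)` LEVEL-INDEXED (= DEF-1's `RunConstRemainder β (k ↦ β_k(γ₀̄)) (Lγ₀) γ₀`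
spelled inline). [cite: Balaban1987RG1, Thm 3 p.264 with (0.20) p.256, (5.10) p.293 (statement shapes)] -/
theorem runRem_constHist_of_rowMass (hL : HistLipschitz Λ γ β) (hM : ∀ k, ∑ i : Fin (k + 1), |Λ k i| ≤ L) {γ₀ : ℝ} (hγ₀ : 0 < γ₀) (hγ₀γ : γ₀ ≤ γ) :
    ∀ (n : ℕ) (gs : ℕ → ℝ), RGEqH n β gs → Step.InInterval γ₀ n gs →
      ∀ k, k ≤ n → |β k (prefixOf gs k) - β k (fun _ : Fin (k + 1) => γ₀)| ≤ L * γ₀ := by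
  intro n gs _ hI k hk
  have hp : prefixOf gs k ∈ Box γ k := prefixOf_mem_box_of_inInterval (fun i hi => ⟨(hI i hi).1, (hI i hi).2.trans hγ₀γ⟩) hk
  have hq : (fun _ : Fin (k + 1) => γ₀) ∈ Box γ k := mem_box.mpr fun _ => ⟨hγ₀, hγ₀γ⟩
  exact abs_sub_le_rowMass hL hM hp hq hγ₀.le fun i => by
    rw [prefixOf_apply, abs_sub_le_iff]
    have := hI i (by have := i.isLt; omega)
    constructor <;> linarith [this.1, this.2]

/-- **★★ THE ROWS TRIPLE IN ROW-MASS CURRENCY — bflow-p2's (α) `rowsTriple_of_runs_moduli` WITHOUT FADING MEMORY** (idea-7 g13 `rowsTriple_of_runs_rowMass`).  `HistLipschitz Λ γ β` with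
row mass `≤ L` (`γ > 0`) + the displayed (0.31)-run family at slope `s > 0` ⟹ `∃ b r γ₀ M, 0 < γ₀ ≤ γ ∧ (i) ∧ (iv) ∧ (C)` in the exact inline shape of DEF-1's `RunRowsCont13`:
`γ₀ = min γ (s∕(4(L+1)))`, `b_k = β_k(γ₀̄)`, `r = Lγ₀`, `M = 4L²∕s²` (`betaAvgAFH_of_runs_rowMass` ⟶ `.partialSums` ⟶ pub-balaban-gaps' `runwisePS_of_betaPartialSumsLowerH`), (C) = bflow-p2
part 12's `survCont_of_moduli` BY NAME.  ANCHOR-FREE, JET-FREE, DRIFT-FREE, CAP-FREE, NE4-FREE, FADING-FREE.  PRICE (CRIT-2 ROUND 8 finding (κ); idea-7 g13's `topStep_lower_of_discrete031`,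
ported in the sibling `…Keyed`): «a displayed (0.20)-run of depth `K ≥ 1` with `Step.Discrete031 s s′ K (r K) r` forces `s ≤ β (K−1) (prefixOf r (K−1))`» — the (α♭) hypothesis `hruns`
already CARRIES a pointwise AF-sign datum (`β ≥ s > 0` on one in-box history of every length), which is what the floor (iv) is made of: this road sits at the same (D1)∕AF-sign wall as the
corner road's `0 < s` in `OneLoopDrift`, in another currency.  CONDITIONAL on the displayed hypotheses; nothing of Bałaban's β asserted.
[cite: Balaban1987RG1, Thm 2 (0.31) p.259, Thm 3 p.264, §1 pp.263-264, (5.10) p.293, §5 p.298] -/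
theorem rowsTriple_of_runs_rowMass (hL : HistLipschitz Λ γ β) (hM : ∀ k, ∑ i : Fin (k + 1), |Λ k i| ≤ L) (hγ : 0 < γ) (hs : 0 < s)
    (hruns : ∀ K : ℕ, ∃ r : ℕ → ℝ, RGEqH K β r ∧ Step.InInterval γ K r ∧ Step.Discrete031 s s' K (r K) r) :
    ∃ (b : ℕ → ℝ) (r γ₀ M : ℝ), 0 < γ₀ ∧ γ₀ ≤ γ ∧
      (∀ (n : ℕ) (gs : ℕ → ℝ), RGEqH n β gs → Step.InInterval γ₀ n gs → ∀ k, k ≤ n → |β k (prefixOf gs k) - b k| ≤ r) ∧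
      (∀ (n : ℕ) (gs : ℕ → ℝ), RGEqH n β gs → Step.InInterval γ₀ n gs →
        ∀ k, k ≤ n → -M ≤ ∑ j ∈ Ico k n, β j (prefixOf gs j)) ∧
      ∀ k : ℕ, ContinuousOn (fun x : ℝ => β k (clampPrefix β γ₀ k x))
        {x : ℝ | 0 < x ∧ x ≤ γ₀ ∧ ∀ j, j ≤ k → 1 / γ₀ ^ 2 ≤ Y β γ₀ j x} := by
  have hL0 : 0 ≤ L := rowMass_nonneg hM
  set γ₀ : ℝ := min γ (s / (4 * (L + 1))) with hγ₀def
  have hγ₀ : 0 < γ₀ := lt_min hγ (by positivity)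
  have hγ₀γ : γ₀ ≤ γ := min_le_left _ _
  have hsmall : 4 * L * γ₀ ≤ s := by
    have h1 : γ₀ ≤ s / (4 * (L + 1)) := min_le_right _ _
    have h2 : γ₀ * (4 * (L + 1)) ≤ s := (le_div_iff₀ (by positivity)).mp h1
    nlinarith [hγ₀.le]
  refine ⟨fun k => β k (fun _ => γ₀), L * γ₀, γ₀, 4 * L ^ 2 / s ^ 2, hγ₀, hγ₀γ, runRem_constHist_of_rowMass hL hM hγ₀ hγ₀γ, ?_,
    survCont_of_moduli hL hγ₀ hγ₀γ⟩
  have hps := (betaAvgAFH_of_runs_rowMass hL hM hγ₀ hγ₀γ hs hsmall hruns).partialSums (by positivity)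
  exact runwisePS_of_betaPartialSumsLowerH hγ₀ hps

/-- **★★ THE BOUNDED ROWS IN ROW-MASS CURRENCY** (NEW in the port — the shape the REGISTERED K1 stub texts and the END road ask, with the extra row `b ≤ B`): the same data give
`∃ b r γ₀ B M, 0 < γ₀ ≤ γ ∧ (i) ∧ (∀ k, b_k ≤ B) ∧ B + r ≤ s′ + 2Lγ + 2L∕√s ∧ (iv) ∧ (C)` with `B = s′ + Lγ₀ + 2L∕√s` (`constHist_le_of_runs_rowMass`), `r = Lγ₀ ≤ Lγ`, everything else as in
`rowsTriple_of_runs_rowMass`.  So at ANY ceiling `c ≥ s′ + 2Lγ + 2L∕√s` the run-letter bundle of the K1 stubs is available on this road (sibling file `…Keyed`).  CONDITIONAL; nothing of Bałaban's β asserted.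
[cite: Balaban1987RG1, Thm 2 (0.31) p.259, (1.22) p.264, Thm 3 p.264, §1 pp.263-264, (5.10) p.293, §5 p.298] -/
theorem rowsBounded_of_runs_rowMass (hL : HistLipschitz Λ γ β) (hM : ∀ k, ∑ i : Fin (k + 1), |Λ k i| ≤ L) (hγ : 0 < γ) (hs : 0 < s)
    (hruns : ∀ K : ℕ, ∃ r : ℕ → ℝ, RGEqH K β r ∧ Step.InInterval γ K r ∧ Step.Discrete031 s s' K (r K) r) :
    ∃ (b : ℕ → ℝ) (r γ₀ B M : ℝ), 0 < γ₀ ∧ γ₀ ≤ γ ∧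
      (∀ (n : ℕ) (gs : ℕ → ℝ), RGEqH n β gs → Step.InInterval γ₀ n gs → ∀ k, k ≤ n → |β k (prefixOf gs k) - b k| ≤ r) ∧
      (∀ k, b k ≤ B) ∧ B + r ≤ s' + 2 * L * γ + 2 * L / Real.sqrt s ∧
      (∀ (n : ℕ) (gs : ℕ → ℝ), RGEqH n β gs → Step.InInterval γ₀ n gs →
        ∀ k, k ≤ n → -M ≤ ∑ j ∈ Ico k n, β j (prefixOf gs j)) ∧
      ∀ k : ℕ, ContinuousOn (fun x : ℝ => β k (clampPrefix β γ₀ k x))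
        {x : ℝ | 0 < x ∧ x ≤ γ₀ ∧ ∀ j, j ≤ k → 1 / γ₀ ^ 2 ≤ Y β γ₀ j x} := by
  have hL0 : 0 ≤ L := rowMass_nonneg hM
  set γ₀ : ℝ := min γ (s / (4 * (L + 1))) with hγ₀def
  have hγ₀ : 0 < γ₀ := lt_min hγ (by positivity)
  have hγ₀γ : γ₀ ≤ γ := min_le_left _ _
  have hsmall : 4 * L * γ₀ ≤ s := by
    have h1 : γ₀ ≤ s / (4 * (L + 1)) := min_le_right _ _
    have h2 : γ₀ * (4 * (L + 1)) ≤ s := (le_div_iff₀ (by positivity)).mp h1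
    nlinarith [hγ₀.le]
  have hsum : s' + L * γ₀ + 2 * L / Real.sqrt s + L * γ₀ ≤ s' + 2 * L * γ + 2 * L / Real.sqrt s := by
    have := mul_le_mul_of_nonneg_left hγ₀γ hL0
    linarith
  refine ⟨fun k => β k (fun _ => γ₀), L * γ₀, γ₀, s' + L * γ₀ + 2 * L / Real.sqrt s, 4 * L ^ 2 / s ^ 2, hγ₀, hγ₀γ, runRem_constHist_of_rowMass hL hM hγ₀ hγ₀γ,
    constHist_le_of_runs_rowMass hL hM hγ₀ hγ₀γ hs hruns, hsum, ?_, survCont_of_moduli hL hγ₀ hγ₀γ⟩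
  have hps := (betaAvgAFH_of_runs_rowMass hL hM hγ₀ hγ₀γ hs hsmall hruns).partialSums (by positivity)
  exact runwisePS_of_betaPartialSumsLowerH hγ₀ hps

end Rows

/-! ## §4 Keyed to the route (minimal; the LINE-2 ∕ V-rung editions are the sibling file `…Keyed`): DEF-1's `RunRowsCont13` at a tuple, `RowsContAll` from the ∀θ letter, K1⁸ ∕ K1⁹ BY NAME -/

section Keyed

variable {F : T4Family}

/-- **THE ROW-MASS ROAD AT THE TUPLE ⟹ DEF-1's `RunRowsCont13 F θ`** (idea-7 g13 `runRowsCont13_of_rowMass_runs`; bflow-p2 #70b's `runRowsCont13_of_moduli_runs` with `FadingMemory` replaced by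
a row-mass bound; read through DEF-1's `runRowsCont13_iff_inline`).  CONDITIONAL on the displayed letters (inhabited at no θ here); nothing of Bałaban's β asserted.
[cite: Balaban1987RG1, Thm 2 (0.31) p.259, Thm 3 p.264, §1 pp.263-264, (5.10) p.293, §5 p.298] -/
theorem runRowsCont13_of_rowMass_runs (θ : Node00.Stage13HParams F 2) {γ L s s' : ℝ} {Λ : ℕ → ℕ → ℝ}
    (hL : HistLipschitz Λ γ (Node00.betaOfRecord₁₃ F 2 θ.toStage13Params)) (hM : ∀ k, ∑ i : Fin (k + 1), |Λ k i| ≤ L) (hγ : 0 < γ) (hs : 0 < s)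
    (hruns : ∀ K : ℕ, ∃ r : ℕ → ℝ, RGEqH K (Node00.betaOfRecord₁₃ F 2 θ.toStage13Params) r ∧ Step.InInterval γ K r ∧
      Step.Discrete031 s s' K (r K) r) :
    RunRowsCont13 F θ := by
  obtain ⟨b, r, γ₀, M, hγ₀, -, hi, hiv, hC⟩ := rowsTriple_of_runs_rowMass hL hM hγ hs hruns
  exact (runRowsCont13_iff_inline F θ).mpr ⟨b, r, γ₀, M, hγ₀, hi, hiv, hC⟩

/-- **THE ∀θ ROW-MASS-RUNS LETTER ⟹ DEF-1's SUPPLIER PROGRAMME `RowsContAll`** (idea-7 g13 `rowsContAll_of_rowMassRunsAll`, its `def RowMassRunsAll` spelled INLINE as the hypothesis — at every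
admissible Stage-13 tuple with provisos: U3ᴷ-lite moduli WITH ROW MASS on some box `]0, γ]` and ONE lower-(0.31) run of `β_θ` per depth at some slope `s > 0`; DEF-1's `rowsContAll_of_adm`
BY NAME).  HYPOTHESIS SHAPE displayed, inhabited nowhere here; CONDITIONAL. [cite: Balaban1987RG1, Thm 2 (0.31) p.259, Thm 3 p.264, §5 p.298] -/
theorem rowsContAll_of_rowMassRunsText
    (h : ∀ (F : T4Family) (θ : Node00.Stage13HParams F 2), θ.Provisos₁₃SepCoPH F 2 → θ.Admissible F 2 →
      ∃ (γ L s s' : ℝ) (Λ : ℕ → ℕ → ℝ), HistLipschitz Λ γ (Node00.betaOfRecord₁₃ F 2 θ.toStage13Params) ∧ (∀ k, ∑ i : Fin (k + 1), |Λ k i| ≤ L) ∧ 0 < γ ∧ 0 < s ∧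
        ∀ K : ℕ, ∃ r : ℕ → ℝ, RGEqH K (Node00.betaOfRecord₁₃ F 2 θ.toStage13Params) r ∧ Step.InInterval γ K r ∧ Step.Discrete031 s s' K (r K) r) :
    RowsContAll :=
  rowsContAll_of_adm fun F θ hP hθ => by
    obtain ⟨γ, L, s, s', Λ, hL, hM, hγ, hs, hruns⟩ := h F θ hP hθ
    exact runRowsCont13_of_rowMass_runs θ hL hM hγ hs hruns

/-- **★ THE DECIDING CRUX DECL K1⁹ `…Theses.BalabanUVNodes.StabilityBRunRowsAtRecordR13SepCoPHV` (stmt-QuantumFields-27364) BY NAME FROM THE ASIDE DECL K1⁷ + THE ∀θ ROW-MASS-RUNS LETTER**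
(idea-7 g13 ED.2 `stabilityBRunRowsAtRecordR13SepCoPHV_of_k17_rowMassRunsAll`): via DEF-1's K1⁸ door `stabilityBRunRowsAtRecordR13SepCoPH_of_k17_rowsContAll` and the `refl`-slot door
`…K1R9VersionSlotDefs.stabilityBRunRowsAtRecordR13SepCoPHV_of_k1R8` (p624736).  2ᶜᴰ-free, N17-free, anchor-free, fading-free.  CONDITIONAL on both hypothesis texts (none supplied here); K1⁹ NOT
closed; counts unmoved; nothing of Bałaban asserted. [cite: Balaban1989LargeFieldII, Thm 1 p.355; Balaban1987RG1, Thm 2 (0.31) p.259, Thm 3 p.264, (2.12)-(2.14) p.268, (5.10) p.293] -/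
theorem stabilityBRunRowsAtRecordR13SepCoPHV_of_k17_rowMassRunsText (h1 : StabilityBAtRecordR13SepCoPH)
    (h : ∀ (F : T4Family) (θ : Node00.Stage13HParams F 2), θ.Provisos₁₃SepCoPH F 2 → θ.Admissible F 2 →
      ∃ (γ L s s' : ℝ) (Λ : ℕ → ℕ → ℝ), HistLipschitz Λ γ (Node00.betaOfRecord₁₃ F 2 θ.toStage13Params) ∧ (∀ k, ∑ i : Fin (k + 1), |Λ k i| ≤ L) ∧ 0 < γ ∧ 0 < s ∧
        ∀ K : ℕ, ∃ r : ℕ → ℝ, RGEqH K (Node00.betaOfRecord₁₃ F 2 θ.toStage13Params) r ∧ Step.InInterval γ K r ∧ Step.Discrete031 s s' K (r K) r) :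
    StabilityBRunRowsAtRecordR13SepCoPHV :=
  stabilityBRunRowsAtRecordR13SepCoPHV_of_k1R8 (stabilityBRunRowsAtRecordR13SepCoPH_of_k17_rowsContAll h1 (rowsContAll_of_rowMassRunsText h))

end Keyed

end Summit.QuantumFields.YangMills.Theorems.BalabanUVNodesK2CornerRoadRowMassRuns

end
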